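import Summits.BirchSwinnertonDyer.BirchSwinnertonDyer.Theorems.ByReductionTypeAtTwoFlatWitnessPrime
import Mathlib.NumberTheory.LSeries.PrimesInAP
import Mathlib.NumberTheory.LegendreSymbol.QuadraticReciprocity
import HarnessLib

/-!
# crux-triage r1 seat 2 — GEN 11 companion: the flat witness (W) at EVERY odd level — the v9 registered stub
# `stub_flatWitnessAtTwoComposite` (line `kato_free_lower_sandwich_two`, crux `OrdMissingLowerBoundAtTwo`) PROVED VERBATIM

Crux `OrdMissingLowerBoundAtTwo` (stmt-BirchSwinnertonDyer-19577), line `kato-free-lower-sandwich-two`, skeleton v9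
(registered 2026-08-28T20:24Z) stub `stub_flatWitnessAtTwoComposite` (composite odd `N > 1`).  The v9 docstring and the
header of `Theorems/ByReductionTypeAtTwoFlatWitnessPrime.lean` (p664510) describe the only family without a single
parabolic/elliptic witness — squarefree products of primes `≡ 1 (mod 4)` with `v₂(r_G) ≤ 1` — as needing «every coprime
class mod `N` contains a prime `ℓ` with `ord_ℓ(2)` odd, a Chebotarev/Hasse density fact … no elementary proof on file».
This file proves that input from Mathlib's DIRICHLET theorem (`Nat.forall_exists_prime_gt_and_eq_mod`) and the second
supplementary law (no Chebotarev), assembles the TWO-ELLIPTIC WITNESS of TRIAGE-r1-2.md GEN 10 §N1 (F3), and then closes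
(W) at every odd level `N > 1` with the two explicit groups `H♯ = {u : u^{6N} = ±1}` / `H♭ = {u : u^{3N} = ±1}`:

* §A `odd_orderOf_two_of_prime_mod_eight_eq_seven`, `exists_prime_gt_natCast_eq_odd_orderOf_two` (Theorem A).
* §R residue lemmas: parabolic `(d ∓ 1)² ≡ 0 ⟹ d^N ≡ ±1, d^{6N} ≡ 1`; order-4 `d² ≡ −1 ⟹ d^{6N} ≡ −1`; order-3/6
  `d² ∓ d + 1 ≡ 0 ⟹ d⁶ ≡ 1`; hence `gamma0Map_pow_six_mul` / `gamma0Map_pow_three_mul`: every killed residue lies in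
  `H♯` (any odd `N`) / `H♭` (odd `N`, `−1` a non-square), given the trace of a killed element is in `{0, ±1, ±2}`.
* §Z the ζ-lemma `pow_half_orderOf_eq_neg_one_of_pow_eq_neg_one`: `2^M ≡ −1 ⟹ ord` even and `2^{ord/2} ≡ −1`.
* §F3 (copied from the GEN 10 companion, namespace renamed) `exists_prodEll4`.
* §W **`exists_twoElliptic_witness`**: `N` odd, `N > 1`, `c² = −1` in `ℤ/N`, `o := ord_N(2)` even ⟹ there is
  `ρ ∈ ⟨finite-order, trace ±2⟩ ≤ Γ₀(N)` with `d(ρ) = 2^{(o/2)·m}`, `m` ODD; **`gcd_dvd_of_pow_six_mul`**: with `H = H♯`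
  and `ζ := 2^{o/2} ≢ −1`, `2^{6Ne} ∈ {±1} ⟹ gcd((o/2)·m, 4) ∣ e`.
* §T the trace lemma `trEntry_mem_of_isOfFinOrder` as a COROLLARY of the lead's landed trace growth
  `FlatWitnessTwo.abs_trace_pow_lt_succ` (p664075).
* §C **assembly**: `Hpow N c = {u : u^{cN} = ±1}` as a `Subgroup (ZMod N)ˣ`, admissibility `Hsharp_admissible` /
  `Hflat_admissible`, `flatW_of_not_isSquare` (H♭, one parabolic witness), `flatW_of_isSquare` (H♯; cases A3 / A2′ /
  B2a / B2b of TRIAGE-r1-2.md GEN 11 §N2), **`flatW` = (W) at every odd `N > 1`**, **`flatWitnessAtTwoComposite` = the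
  v9 stub statement VERBATIM**, and `flatWitnessAtTwo_all` (every odd `N`, via the lead's `flatWitnessAtTwo_of_composite`).

`lean check`: rc 0, 0 sorry, 0 warning; `#print axioms flatWitnessAtTwo_all` = {propext, Classical.choice, Quot.sound}.
Nothing here states a Theses decl and this refuter seat lands no positive statement: the §C theorems are CANDIDATE PROOFS
attached as evidence on stmt-BirchSwinnertonDyer-19577 for the lead (cruxlead-19577) to land with stub credit.
BSD is not proved by any of this: the line's research heart (β) `stub_periodDescentOfEisenstein` and the two external
by-name stubs (PUB 19167, λ-half 19556) are untouched.
-/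

noncomputable section

open scoped Classical MatrixGroups ModularForm

open CongruenceSubgroup Literature.NumberTheory.EllipticCurves.Rank1Residual
  Literature.NumberTheory.EllipticCurves.ModularForms Summit.BirchSwinnertonDyer.BirchSwinnertonDyer.Theorems

namespace TriageR1Seat2Gen11

/-! ## §A — Dirichlet input -/

/-- For a prime `ℓ ≡ 7 (mod 8)` the multiplicative order of `2` modulo `ℓ` is odd. [folklore] -/
theorem odd_orderOf_two_of_prime_mod_eight_eq_seven (ℓ : ℕ) (hℓ : ℓ.Prime) (h8 : ℓ % 8 = 7) :
    Odd (orderOf (2 : ZMod ℓ)) := by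
  haveI : Fact ℓ.Prime := ⟨hℓ⟩
  have hℓ2 : ℓ ≠ 2 := by rintro rfl; norm_num at h8
  have h2ne : (2 : ZMod ℓ) ≠ 0 := by
    intro h
    have h' : ((2 : ℕ) : ZMod ℓ) = 0 := by exact_mod_cast h
    rw [ZMod.natCast_eq_zero_iff] at h'
    exact hℓ2 ((Nat.prime_dvd_prime_iff_eq hℓ Nat.prime_two).mp h')
  have hsq : IsSquare (2 : ZMod ℓ) := (ZMod.exists_sq_eq_two_iff hℓ2).mpr (Or.inr h8)
  have hpow : (2 : ZMod ℓ) ^ (ℓ / 2) = 1 := (ZMod.euler_criterion ℓ h2ne).mp hsq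
  have hdvd : orderOf (2 : ZMod ℓ) ∣ ℓ / 2 := orderOf_dvd_of_pow_eq_one hpow
  have hodd : Odd (ℓ / 2) := Nat.odd_iff.mpr (by omega)
  exact hodd.of_dvd_nat hdvd

/-- **Theorem A.**  For `N` odd, a unit class `c` mod `N` and any bound `n`, there is a prime `ℓ > n` with
`ℓ ≡ c (mod N)` and `ord_ℓ(2)` odd (Dirichlet for the unit class `(7, c)` of `ℤ/8 × ℤ/N ≅ ℤ/8N`). [folklore] -/
theorem exists_prime_gt_natCast_eq_odd_orderOf_two (N : ℕ) (hN : Odd N) (c : ZMod N) (hc : IsUnit c) (n : ℕ) :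
    ∃ ℓ : ℕ, n < ℓ ∧ ℓ.Prime ∧ (ℓ : ZMod N) = c ∧ Odd (orderOf (2 : ZMod ℓ)) := by
  have hcop : Nat.Coprime 8 N := by
    have h2 : Nat.Coprime 2 N := Nat.coprime_two_left.mpr hN
    simpa using h2.pow_left 3
  have hN0 : N ≠ 0 := by rintro rfl; exact absurd hN (by decide)
  haveI : NeZero (8 * N) := ⟨by positivity⟩
  set e : ZMod (8 * N) ≃+* ZMod 8 × ZMod N := ZMod.chineseRemainder hcop with he
  set x : ZMod (8 * N) := e.symm (7, c) with hx
  have h7 : IsUnit (7 : ZMod 8) := IsUnit.of_mul_eq_one (7 : ZMod 8) (by decide)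
  have hxu : IsUnit x := by
    have : IsUnit ((7 : ZMod 8), c) := Prod.isUnit_iff.mpr ⟨h7, hc⟩
    rw [hx]
    exact this.map e.symm
  obtain ⟨ℓ, hgt, hℓp, hℓx⟩ := Nat.forall_exists_prime_gt_and_eq_mod hxu n
  have himg : e (ℓ : ZMod (8 * N)) = ((ℓ : ZMod 8), (ℓ : ZMod N)) := by
    rw [map_natCast]; ext <;> simp
  have hpair : ((ℓ : ZMod 8), (ℓ : ZMod N)) = ((7 : ZMod 8), c) := by
    rw [← himg, hℓx, hx, RingEquiv.apply_symm_apply]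
  have h8 : (ℓ : ZMod 8) = 7 := congrArg Prod.fst hpair
  have hcN : (ℓ : ZMod N) = c := congrArg Prod.snd hpair
  have hmod : ℓ % 8 = 7 := by
    have hv := congrArg ZMod.val h8
    rw [ZMod.val_natCast] at hv
    exact hv
  exact ⟨ℓ, hgt, hℓp, hcN, odd_orderOf_two_of_prime_mod_eight_eq_seven ℓ hℓp hmod⟩

/-! ## §R — residues of killed elements -/

/-- `z² = 0 ⟹ (1 + z)ⁿ = 1 + n·z`. [folklore] -/
theorem one_add_pow_of_sq_eq_zero {R : Type*} [CommRing R] (z : R) (hz : z ^ 2 = 0) (n : ℕ) :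
    (1 + z) ^ n = 1 + (n : R) * z := by
  induction n with
  | zero => simp
  | succ n ih =>
    rw [pow_succ, ih]
    push_cast
    linear_combination (n : R) * hz

/-- Parabolic residues: `(d − s)² = 0` in `ℤ/N`, `s = ±1` ⟹ `d^N = s^N`. [folklore] -/
theorem pow_eq_of_sub_sq_eq_zero (N : ℕ) (d s : ZMod N) (hs : s = 1 ∨ s = -1) (h : (d - s) ^ 2 = 0) :
    d ^ N = s ^ N := by
  have hs2 : s ^ 2 = 1 := by rcases hs with rfl | rfl <;> norm_num
  have hz : (s * (d - s)) ^ 2 = 0 := by rw [mul_pow, h, mul_zero]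
  have hd : d = s * (1 + s * (d - s)) := by linear_combination (-(d - s)) * hs2
  have key := one_add_pow_of_sq_eq_zero (s * (d - s)) hz N
  rw [ZMod.natCast_self, zero_mul, add_zero] at key
  rw [hd, mul_pow, key, mul_one]

/-- Parabolic residues at odd level: `d^N = s`, `d^(3N) = s`, `d^(6N) = 1`. [folklore] -/
theorem pow_of_sub_sq_eq_zero_odd (N : ℕ) (hN : Odd N) (d s : ZMod N) (hs : s = 1 ∨ s = -1)
    (h : (d - s) ^ 2 = 0) : d ^ N = s ∧ d ^ (3 * N) = s ∧ d ^ (6 * N) = 1 := by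
  have hsN : s ^ N = s := by rcases hs with rfl | rfl <;> simp [hN.neg_one_pow]
  have h1 : d ^ N = s := by rw [pow_eq_of_sub_sq_eq_zero N d s hs h, hsN]
  have hs2 : s ^ 2 = 1 := by rcases hs with rfl | rfl <;> norm_num
  have hs3 : s ^ 3 = s := by linear_combination s * hs2
  refine ⟨h1, ?_, ?_⟩
  · rw [mul_comm, pow_mul, h1, hs3]
  · rw [show 6 * N = N * 6 by ring, pow_mul, h1, show (6 : ℕ) = 2 * 3 by rfl, pow_mul, hs2, one_pow]

/-- Order-4 residues: `d² = −1`, `N` odd ⟹ `d^(6N) = −1`. [folklore] -/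
theorem pow_six_mul_of_sq_eq_neg_one (N : ℕ) (hN : Odd N) (d : ZMod N) (h : d ^ 2 = -1) :
    d ^ (6 * N) = -1 := by
  have h3 : Odd (3 * N) := by
    obtain ⟨m, rfl⟩ := hN
    exact ⟨3 * m + 1, by ring⟩
  rw [show 6 * N = 2 * (3 * N) by ring, pow_mul, h, h3.neg_one_pow]

/-- Order-3/6 residues: `d² − t d + 1 = 0` with `t = ±1` ⟹ `d⁶ = 1`. [folklore] -/
theorem pow_six_of_sq_sub_add_one {R : Type*} [CommRing R] (d t : R) (ht : t = 1 ∨ t = -1)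
    (h : d ^ 2 - t * d + 1 = 0) : d ^ 6 = 1 := by
  rcases ht with rfl | rfl
  · have h3 : d ^ 3 = -1 := by linear_combination (d + 1) * h
    linear_combination (d ^ 3 - 1) * h3
  · have h3 : d ^ 3 = 1 := by linear_combination (d - 1) * h
    linear_combination (d ^ 3 + 1) * h3

/-- `d² − t·d + 1 ≡ 0 (mod N)` for every `γ = (a b; c d) ∈ Γ₀(N)` (`t` the trace).  (GEN 10 companion.) [folklore] -/
theorem dEntry_sq_sub_tr_mul_add_one {N : ℕ} (γ : Gamma0 N) :
    ((dEntry γ ^ 2 - trEntry γ * dEntry γ + 1 : ℤ) : ZMod N) = 0 := by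
  have hdet : ((γ : SL(2, ℤ)) : Matrix (Fin 2) (Fin 2) ℤ).det = 1 := (γ : SL(2, ℤ)).det_coe
  rw [Matrix.det_fin_two] at hdet
  have hc : ((((γ : SL(2, ℤ)) : Matrix (Fin 2) (Fin 2) ℤ) 1 0 : ℤ) : ZMod N) = 0 := Gamma0_mem.1 γ.2
  have e : (dEntry γ ^ 2 - trEntry γ * dEntry γ + 1 : ℤ)
      = -(((γ : SL(2, ℤ)) : Matrix (Fin 2) (Fin 2) ℤ) 0 1) * ((γ : SL(2, ℤ)) : Matrix (Fin 2) (Fin 2) ℤ) 1 0 := by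
    simp only [dEntry, trEntry]
    linear_combination (-1 : ℤ) * hdet
  rw [e]
  push_cast
  rw [hc, mul_zero]

/-- **Admissibility of `H♯ = {u : u^{6N} = ±1}` (odd `N`)**, modulo the trace lemma: every `γ ∈ Γ₀(N)` with
`tr γ ∈ {0, ±1, ±2}` (all finite-order elements, by GEN 10's `trEntry_mem_of_isOfFinOrder`, and the parabolics) has
`d(γ)^{6N} ≡ ±1 (mod N)`. [folklore] -/
theorem gamma0Map_pow_six_mul {N : ℕ} (hN : Odd N) (γ : Gamma0 N)
    (ht : trEntry γ = 0 ∨ trEntry γ = 1 ∨ trEntry γ = -1 ∨ trEntry γ = 2 ∨ trEntry γ = -2) :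
    Gamma0Map N γ ^ (6 * N) = 1 ∨ Gamma0Map N γ ^ (6 * N) = -1 := by
  have hrel := dEntry_sq_sub_tr_mul_add_one γ
  rw [← intCast_dEntry]
  set d : ZMod N := ((dEntry γ : ℤ) : ZMod N) with hd
  rcases ht with h | h | h | h | h <;> rw [h] at hrel <;> push_cast at hrel
  · -- order 4: d² + 1 = 0
    right
    exact pow_six_mul_of_sq_eq_neg_one N hN d (by linear_combination hrel)
  · left
    have h6 := pow_six_of_sq_sub_add_one d 1 (Or.inl rfl) (by linear_combination hrel)
    rw [pow_mul, h6, one_pow]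
  · left
    have h6 := pow_six_of_sq_sub_add_one d (-1) (Or.inr rfl) (by linear_combination hrel)
    rw [pow_mul, h6, one_pow]
  · left
    exact (pow_of_sub_sq_eq_zero_odd N hN d 1 (Or.inl rfl) (by linear_combination hrel)).2.2
  · left
    exact (pow_of_sub_sq_eq_zero_odd N hN d (-1) (Or.inr rfl) (by linear_combination hrel)).2.2

/-- **Admissibility of `H♭ = {u : u^{3N} = ±1}` (odd `N` with `−1` a NON-square mod `N`)**, modulo the trace lemma:
trace `0` cannot occur, and the other killed residues have `d^{3N} ≡ ±1`. [folklore] -/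
theorem gamma0Map_pow_three_mul {N : ℕ} (hN : Odd N) (hi : ¬ IsSquare (-1 : ZMod N)) (γ : Gamma0 N)
    (ht : trEntry γ = 0 ∨ trEntry γ = 1 ∨ trEntry γ = -1 ∨ trEntry γ = 2 ∨ trEntry γ = -2) :
    Gamma0Map N γ ^ (3 * N) = 1 ∨ Gamma0Map N γ ^ (3 * N) = -1 := by
  have hrel := dEntry_sq_sub_tr_mul_add_one γ
  rw [← intCast_dEntry]
  set d : ZMod N := ((dEntry γ : ℤ) : ZMod N) with hd
  rcases ht with h | h | h | h | h <;> rw [h] at hrel <;> push_cast at hrel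
  · exact absurd ⟨d, by linear_combination (-1 : ZMod N) * hrel⟩ hi
  · right
    have h3 : d ^ 3 = -1 := by linear_combination (d + 1) * hrel
    rw [pow_mul, h3, hN.neg_one_pow]
  · left
    have h3 : d ^ 3 = 1 := by linear_combination (d - 1) * hrel
    rw [pow_mul, h3, one_pow]
  · left
    exact (pow_of_sub_sq_eq_zero_odd N hN d 1 (Or.inl rfl) (by linear_combination hrel)).2.1
  · right
    exact (pow_of_sub_sq_eq_zero_odd N hN d (-1) (Or.inr rfl) (by linear_combination hrel)).2.1

/-! ## §Z — the ζ-lemma -/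

/-- **ζ-lemma.**  If `2^M ≡ −1 (mod N)` with `N > 2`, then `o := ord_N(2)` is even and `2^{o/2} ≡ −1 (mod N)`.
Contrapositive use: when `ζ := 2^{o/2} ≢ −1` (or `o` is odd) NO power of `2` is `≡ −1`, so a hypothesis
`2^{cNe} ≡ ±1` collapses to `o ∣ cNe`. [folklore] -/
theorem pow_half_orderOf_eq_neg_one_of_pow_eq_neg_one {N : ℕ} [Fact (2 < N)] (M : ℕ)
    (h : (2 : ZMod N) ^ M = -1) :
    Even (orderOf (2 : ZMod N)) ∧ (2 : ZMod N) ^ (orderOf (2 : ZMod N) / 2) = -1 := by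
  set o := orderOf (2 : ZMod N) with ho_def
  have h2M : (2 : ZMod N) ^ (2 * M) = 1 := by
    rw [mul_comm, pow_mul, h]; norm_num
  have ho : o ∣ 2 * M := orderOf_dvd_of_pow_eq_one h2M
  have hnot : ¬ o ∣ M := by
    intro hd
    have h1 : (2 : ZMod N) ^ M = 1 := orderOf_dvd_iff_pow_eq_one.mp hd
    rw [h] at h1
    exact ZMod.neg_one_ne_one h1
  obtain ⟨t, ht⟩ := ho
  have ht_odd : t % 2 = 1 := by
    by_contra hte
    obtain ⟨t', rfl⟩ : 2 ∣ t := Nat.dvd_of_mod_eq_zero (by omega)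
    apply hnot
    refine ⟨t', ?_⟩
    have : 2 * M = 2 * (o * t') := by rw [ht]; ring
    omega
  have ho_even : Even o := by
    have h2 : 2 ∣ o * t := ⟨M, by rw [← ht]⟩
    rcases (Nat.Prime.dvd_mul Nat.prime_two).mp h2 with h | h
    · exact (even_iff_two_dvd).mpr h
    · exact absurd (Nat.mod_eq_zero_of_dvd h) (by omega)
  refine ⟨ho_even, ?_⟩
  have ho2 : 2 * (o / 2) = o := Nat.two_mul_div_two_of_even ho_even
  have hM : M = (o / 2) * t := by
    have : 2 * M = 2 * ((o / 2) * t) := by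
      rw [ht, ← mul_assoc, ho2]
    omega
  have hζ2 : (2 : ZMod N) ^ (o / 2 * 2) = 1 := by
    rw [show o / 2 * 2 = o by omega, ho_def, pow_orderOf_eq_one]
  have hM' : M = (o / 2 * 2) * (t / 2) + o / 2 := by
    have ht' : t = 2 * (t / 2) + 1 := by omega
    rw [hM]
    nth_rewrite 1 [ht']
    ring
  rw [hM', pow_add, pow_mul, hζ2, one_pow, one_mul] at h
  exact h

/-! ## §F3 — the two-elliptic element (from the GEN 10 companion, namespace renamed) -/

/-- The trace-zero matrix `(a, b; c, −a)`. -/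
def ellMat (a b c : ℤ) : Matrix (Fin 2) (Fin 2) ℤ := !![a, b; c, -a]

theorem ellMat_det {a b c : ℤ} (h : a * a + b * c = -1) : (ellMat a b c).det = 1 := by
  rw [ellMat, Matrix.det_fin_two_of]
  linear_combination (-1 : ℤ) * h

theorem ellMat_sq {a b c : ℤ} (h : a * a + b * c = -1) : ellMat a b c ^ 2 = -1 := by
  ext i j
  fin_cases i <;> fin_cases j <;>
    simp [ellMat, pow_two, Matrix.mul_apply, Fin.sum_univ_two] <;> linarith [h, mul_comm b c, mul_comm a b, mul_comm c a]

/-- `ε(a,b,c) ∈ Γ₀(N)` (order `4`). -/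
def ell (N : ℕ) (a b c : ℤ) (h : a * a + b * c = -1) (hc : (N : ℤ) ∣ c) : Gamma0 N :=
  ⟨⟨ellMat a b c, ellMat_det h⟩, by
    rw [Gamma0_mem]
    simp [ellMat, (ZMod.intCast_zmod_eq_zero_iff_dvd c N).2 hc]⟩

theorem ell_pow_four (N : ℕ) (a b c : ℤ) (h : a * a + b * c = -1) (hc : (N : ℤ) ∣ c) :
    ell N a b c h hc ^ 4 = 1 := by
  apply Subtype.ext
  rw [Subgroup.coe_pow, Subgroup.coe_one]
  apply Subtype.ext
  rw [Matrix.SpecialLinearGroup.coe_pow, Matrix.SpecialLinearGroup.coe_one]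
  show ellMat a b c ^ 4 = 1
  rw [show (4 : ℕ) = 2 * 2 from rfl, pow_mul, ellMat_sq h]
  simp

theorem ell_isOfFinOrder (N : ℕ) (a b c : ℤ) (h : a * a + b * c = -1) (hc : (N : ℤ) ∣ c) :
    IsOfFinOrder (ell N a b c h hc) :=
  isOfFinOrder_iff_pow_eq_one.2 ⟨4, by norm_num, ell_pow_four N a b c h hc⟩

theorem dEntry_ell_mul_ell (N : ℕ) (a₁ b₁ c₁ a₂ b₂ c₂ : ℤ) (h₁ : a₁ * a₁ + b₁ * c₁ = -1) (hc₁ : (N : ℤ) ∣ c₁)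
    (h₂ : a₂ * a₂ + b₂ * c₂ = -1) (hc₂ : (N : ℤ) ∣ c₂) :
    dEntry (ell N a₁ b₁ c₁ h₁ hc₁ * ell N a₂ b₂ c₂ h₂ hc₂) = c₁ * b₂ + a₁ * a₂ := by
  simp [dEntry, ell, ellMat, Matrix.mul_apply, Fin.sum_univ_two]

/-- (F3) `ρ = ε(ℓ,−1,ℓ²+1)·ε(q−ℓ,1,−((q−ℓ)²+1))` is a product of two order-`4` elements of `Γ₀(N)` with
`d(ρ) = ℓq + 1`. [folklore] -/
theorem exists_prodEll4 (N : ℕ) (ℓ q : ℤ) (h₁ : (N : ℤ) ∣ ℓ ^ 2 + 1) (h₂ : (N : ℤ) ∣ (q - ℓ) ^ 2 + 1) :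
    ∃ ρ : Gamma0 N, ρ ∈ Subgroup.closure {γ : Gamma0 N | IsOfFinOrder γ ∨ trEntry γ = 2 ∨ trEntry γ = -2} ∧
      dEntry ρ = ℓ * q + 1 := by
  have e₁ : ℓ * ℓ + (-1) * (ℓ ^ 2 + 1) = -1 := by ring
  have e₂ : (q - ℓ) * (q - ℓ) + 1 * (-((q - ℓ) ^ 2 + 1)) = -1 := by ring
  have hc₂ : (N : ℤ) ∣ -((q - ℓ) ^ 2 + 1) := (dvd_neg).2 h₂
  refine ⟨ell N ℓ (-1) (ℓ ^ 2 + 1) e₁ h₁ * ell N (q - ℓ) 1 (-((q - ℓ) ^ 2 + 1)) e₂ hc₂, ?_, ?_⟩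
  · exact Subgroup.mul_mem _ (Subgroup.subset_closure (Or.inl (ell_isOfFinOrder N _ _ _ e₁ h₁)))
      (Subgroup.subset_closure (Or.inl (ell_isOfFinOrder N _ _ _ e₂ hc₂)))
  · rw [dEntry_ell_mul_ell]
    ring

/-! ## §W — the two-elliptic witness EXISTS at every odd level with a square root of `−1` -/

/-- **Existence of the two-elliptic witness (family B2b of TRIAGE-r1-2.md GEN 10 §N1; Dirichlet, not Chebotarev).**
For `N` odd, `N > 1`, `c² = −1` in `ℤ/N` and `o := ord_N(2)` even, there is `ρ` in the subgroup generated by the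
finite-order and trace-`±2` elements of `Γ₀(N)` with `d(ρ) = 2^{(o/2)·m}` for an ODD `m`: take a prime `ℓ ≡ c (mod N)`,
`ℓ ≡ 7 (mod 8)` (Theorem A), `m := ord_ℓ(2)` (odd), `k := (o/2)·m`, `q := (2ᵏ − 1)/ℓ`; then `N ∣ ℓ² + 1`, and
`N ∣ (q − ℓ)² + 1` AUTOMATICALLY (`ℓ²((q−ℓ)²+1) = (ℓq − ℓ²)² + ℓ² ≡ 2^{2k} − 1 ≡ 0`), so (F3) applies with
`d(ρ) = ℓq + 1 = 2ᵏ`. [folklore] -/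
theorem exists_twoElliptic_witness (N : ℕ) (hN : Odd N) (hN1 : 1 < N) (c : ZMod N) (hc : c ^ 2 = -1)
    (ho : Even (orderOf (2 : ZMod N))) :
    ∃ ρ : Gamma0 N, ρ ∈ Subgroup.closure {γ : Gamma0 N | IsOfFinOrder γ ∨ trEntry γ = 2 ∨ trEntry γ = -2} ∧
      ∃ m : ℕ, Odd m ∧ dEntry ρ = 2 ^ (orderOf (2 : ZMod N) / 2 * m) := by
  haveI : NeZero N := ⟨by omega⟩
  set o := orderOf (2 : ZMod N) with ho_def
  have ho2 : 2 * (o / 2) = o := Nat.two_mul_div_two_of_even ho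
  -- the Dirichlet prime
  have hcu : IsUnit c := IsUnit.of_mul_eq_one (-c) (by linear_combination (-1 : ZMod N) * hc)
  obtain ⟨ℓ, hℓgt, hℓp, hℓc, hm⟩ := exists_prime_gt_natCast_eq_odd_orderOf_two N hN c hcu N
  haveI : NeZero ℓ := ⟨hℓp.ne_zero⟩
  set m := orderOf (2 : ZMod ℓ) with hm_def
  set k := o / 2 * m with hk_def
  -- `ℓ ∣ 2^k − 1`
  have h2k : (2 : ZMod ℓ) ^ k = 1 := by
    rw [hk_def, mul_comm, pow_mul, hm_def, pow_orderOf_eq_one, one_pow]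
  have hℓdvd : (ℓ : ℤ) ∣ 2 ^ k - 1 := by
    rw [← ZMod.intCast_zmod_eq_zero_iff_dvd]
    push_cast
    rw [h2k, sub_self]
  obtain ⟨q, hq⟩ := hℓdvd
  -- `N ∣ ℓ² + 1`
  have h₁ : (N : ℤ) ∣ (ℓ : ℤ) ^ 2 + 1 := by
    rw [← ZMod.intCast_zmod_eq_zero_iff_dvd]
    push_cast
    rw [hℓc, hc, neg_add_cancel]
  -- `N ∣ (q − ℓ)² + 1`
  have h2N : ((2 : ZMod N) ^ k) ^ 2 = 1 := by
    rw [← pow_mul, hk_def, show o / 2 * m * 2 = (2 * (o / 2)) * m by ring, ho2, pow_mul, ho_def,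
      pow_orderOf_eq_one, one_pow]
  have hcq : c * (q : ZMod N) = 2 ^ k - 1 := by
    have := congrArg (fun z : ℤ => (z : ZMod N)) hq
    push_cast at this
    rw [hℓc] at this
    exact this.symm
  have h₂ : (N : ℤ) ∣ ((q : ℤ) - ℓ) ^ 2 + 1 := by
    rw [← ZMod.intCast_zmod_eq_zero_iff_dvd]
    push_cast
    rw [hℓc]
    linear_combination (1 + (q : ZMod N) ^ 2) * hc - (c * (q : ZMod N) + 2 ^ k + 1) * hcq - h2N
  obtain ⟨ρ, hρ, hd⟩ := exists_prodEll4 N ℓ q h₁ h₂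
  refine ⟨ρ, hρ, m, hm, ?_⟩
  rw [hd]
  linear_combination (-1 : ℤ) * hq

/-- **The `e`-clause with `H = H♯` when `ζ ≠ −1`.**  `N > 2` odd, `o := ord_N(2)` even, `2^{o/2} ≢ −1`, `m` odd:
if `2^{6Ne} ≡ ±1 (mod N)` then `gcd((o/2)·m, 4) ∣ e`.  (ζ-lemma kills the `−1` branch; then `o ∣ 6Ne`, so
`o/2 ∣ 3Ne`, and `gcd(o/2, 4)` is prime to `3N`.) [folklore] -/
theorem gcd_dvd_of_pow_six_mul {N : ℕ} [Fact (2 < N)] (hN : Odd N) (ho : Even (orderOf (2 : ZMod N)))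
    (hζ : (2 : ZMod N) ^ (orderOf (2 : ZMod N) / 2) ≠ -1) (m : ℕ) (hm : Odd m) (e : ℕ)
    (he : (2 : ZMod N) ^ (6 * N * e) = 1 ∨ (2 : ZMod N) ^ (6 * N * e) = -1) :
    Nat.gcd (orderOf (2 : ZMod N) / 2 * m) 4 ∣ e := by
  set o := orderOf (2 : ZMod N) with ho_def
  have ho2 : 2 * (o / 2) = o := Nat.two_mul_div_two_of_even ho
  have h1 : (2 : ZMod N) ^ (6 * N * e) = 1 := by
    rcases he with h | h
    · exact h
    · exact absurd (pow_half_orderOf_eq_neg_one_of_pow_eq_neg_one _ h).2 hζ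
  have hdvd : o ∣ 6 * N * e := orderOf_dvd_of_pow_eq_one h1
  have hdvd' : o / 2 ∣ (3 * N) * e := by
    have : 2 * (o / 2) ∣ 2 * ((3 * N) * e) := by rw [ho2, show 2 * (3 * N * e) = 6 * N * e by ring]; exact hdvd
    exact Nat.dvd_of_mul_dvd_mul_left (by norm_num) this
  have hm4 : Nat.Coprime m 4 := by
    have : Nat.Coprime m (2 ^ 2) := Nat.Coprime.pow_right 2 (Nat.coprime_two_right.2 hm)
    simpa using this
  rw [hm4.gcd_mul_right_cancel (o / 2)]
  have hg : Nat.gcd (o / 2) 4 ∣ 3 * N * e := (Nat.gcd_dvd_left _ _).trans hdvd'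
  have h3N : Odd (3 * N) := by
    obtain ⟨r, rfl⟩ := hN
    exact ⟨3 * r + 1, by ring⟩
  have hcop : Nat.Coprime (Nat.gcd (o / 2) 4) (3 * N) := by
    have h4 : Nat.Coprime 4 (3 * N) := by simpa using (Nat.coprime_two_left.mpr h3N).pow_left 2
    exact Nat.Coprime.coprime_dvd_left (Nat.gcd_dvd_right _ _) h4
  exact hcop.dvd_of_dvd_mul_left hg


/-! ## §T — the trace lemma, from the lead's trace growth `FlatWitnessTwo.abs_trace_pow_lt_succ` (p664075) -/

/-- (T) An element of finite order of `Γ₀(N)` has trace in `{0, ±1, ±2}`: for `|t| ≥ 3` the traces of `γⁿ` grow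
(`FlatWitnessTwo.abs_trace_pow_lt_succ`), but some `γⁿ = 1` has trace `2`.  (The GEN 10 companion proves the same from
scratch; here it is a corollary of the landed p664075.) [cite: DiamondShurman2005, Exercise 2.3.7 (a)] -/
theorem trEntry_mem_of_isOfFinOrder {N : ℕ} {γ : Gamma0 N} (hγ : IsOfFinOrder γ) :
    trEntry γ = 0 ∨ trEntry γ = 1 ∨ trEntry γ = -1 ∨ trEntry γ = 2 ∨ trEntry γ = -2 := by
  suffices h : |trEntry γ| ≤ 2 by rw [abs_le] at h; omega
  by_contra hlt
  have hbig : 3 ≤ |((γ : SL(2, ℤ)) 0 0 : ℤ) + (γ : SL(2, ℤ)) 1 1| := by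
    have e : trEntry γ = ((γ : SL(2, ℤ)) 0 0 : ℤ) + (γ : SL(2, ℤ)) 1 1 := rfl
    rw [← e]
    omega
  have hγ' : IsOfFinOrder (γ : SL(2, ℤ)) := (Gamma0 N).subtype.isOfFinOrder hγ
  obtain ⟨n, hn, hγn⟩ := hγ'.exists_pow_eq_one
  have hge : ∀ m : ℕ, 3 ≤ |(((γ : SL(2, ℤ)) ^ (m + 1) : SL(2, ℤ)) 0 0 : ℤ) + ((γ : SL(2, ℤ)) ^ (m + 1) : SL(2, ℤ)) 1 1| := by
    intro m
    induction m with
    | zero => simpa using hbig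
    | succ m ih => exact le_trans ih (le_of_lt (FlatWitnessTwo.abs_trace_pow_lt_succ _ hbig (m + 1)))
  obtain ⟨m, rfl⟩ := Nat.exists_eq_succ_of_ne_zero hn.ne'
  have h := hge m
  rw [Nat.succ_eq_add_one] at hγn
  rw [hγn] at h
  have h2 : |((1 : SL(2, ℤ)) 0 0 : ℤ) + (1 : SL(2, ℤ)) 1 1| = 2 := by simp
  rw [h2] at h
  omega

/-- the trace of a «killed» element (finite order, or trace `±2`) is one of `0, ±1, ±2`. [folklore] -/
theorem trEntry_mem_of_killed {N : ℕ} {γ : Gamma0 N} (h : IsOfFinOrder γ ∨ trEntry γ = 2 ∨ trEntry γ = -2) :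
    trEntry γ = 0 ∨ trEntry γ = 1 ∨ trEntry γ = -1 ∨ trEntry γ = 2 ∨ trEntry γ = -2 := by
  rcases h with h | h | h
  · exact trEntry_mem_of_isOfFinOrder h
  · exact Or.inr (Or.inr (Or.inr (Or.inl h)))
  · exact Or.inr (Or.inr (Or.inr (Or.inr h)))

/-! ## §C — (W) ASSEMBLED at every odd level `N > 1`; the v9 stub `stub_flatWitnessAtTwoComposite` verbatim -/

/-- The (W) conclusion at level `N` — verbatim the body of v9 `stub_flatWitnessAtTwoComposite` / v8 `stub_flatWitnessAtTwo`
(= the conclusion of `FlatWitnessTwo.flatWitnessAt_of_single`). -/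
def FlatW (N : ℕ) : Prop :=
    ∃ (H : Subgroup (ZMod N)ˣ) (ρ : Gamma0 N) (k : ℕ), -1 ∈ H ∧
      (∀ γ : Gamma0 N, IsOfFinOrder γ ∨ trEntry γ = 2 ∨ trEntry γ = -2 → ∃ u ∈ H, (u : ZMod N) = Gamma0Map N γ) ∧
      ρ ∈ Subgroup.closure {γ : Gamma0 N | IsOfFinOrder γ ∨ trEntry γ = 2 ∨ trEntry γ = -2} ⊔ commutator (Gamma0 N) ∧
      (dEntry ρ).natAbs = 2 ^ k ∧
      ∀ e : ℕ, (∃ u ∈ H, (u : ZMod N) = 2 ^ e) → Nat.gcd k 4 ∣ e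

/-- `H_c := {u ∈ (ℤ/N)ˣ : u^{c·N} = ±1}` — `c = 6` is `H♯`, `c = 3` is `H♭`. -/
def Hpow (N c : ℕ) : Subgroup (ZMod N)ˣ where
  carrier := {u | (u : ZMod N) ^ (c * N) = 1 ∨ (u : ZMod N) ^ (c * N) = -1}
  mul_mem' := by
    intro u v hu hv
    simp only [Set.mem_setOf_eq, Units.val_mul, mul_pow] at *
    rcases hu with hu | hu <;> rcases hv with hv | hv <;> simp [hu, hv]
  one_mem' := by
    simp only [Set.mem_setOf_eq, Units.val_one, one_pow, true_or]
  inv_mem' := by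
    intro u hu
    simp only [Set.mem_setOf_eq] at *
    have h1 : ((u⁻¹ : (ZMod N)ˣ) : ZMod N) ^ (c * N) * (u : ZMod N) ^ (c * N) = 1 := by
      rw [← mul_pow, Units.inv_mul, one_pow]
    rcases hu with hu | hu
    · left
      rwa [hu, mul_one] at h1
    · right
      rw [hu] at h1
      linear_combination (-1 : ZMod N) * h1

theorem mem_Hpow {N c : ℕ} (u : (ZMod N)ˣ) :
    u ∈ Hpow N c ↔ (u : ZMod N) ^ (c * N) = 1 ∨ (u : ZMod N) ^ (c * N) = -1 := Iff.rfl

theorem neg_one_mem_Hpow (N c : ℕ) : -1 ∈ Hpow N c := by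
  rw [mem_Hpow, Units.val_neg, Units.val_one]
  rcases Nat.even_or_odd (c * N) with h | h
  · exact Or.inl h.neg_one_pow
  · exact Or.inr h.neg_one_pow

/-- the unit attached to `γ` lies in `H_c` as soon as `d(γ)^{cN} ≡ ±1`. -/
theorem exists_mem_Hpow_of_pow {N c : ℕ} (γ : Gamma0 N)
    (h : Gamma0Map N γ ^ (c * N) = 1 ∨ Gamma0Map N γ ^ (c * N) = -1) :
    ∃ u ∈ Hpow N c, (u : ZMod N) = Gamma0Map N γ :=
  ⟨(isUnit_Gamma0Map N γ).unit, by rw [mem_Hpow, IsUnit.unit_spec]; exact h, (isUnit_Gamma0Map N γ).unit_spec⟩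

/-- **`H♯` is admissible at every odd level** ((T) + §R). [folklore] -/
theorem Hsharp_admissible {N : ℕ} (hN : Odd N) (γ : Gamma0 N) (h : IsOfFinOrder γ ∨ trEntry γ = 2 ∨ trEntry γ = -2) :
    ∃ u ∈ Hpow N 6, (u : ZMod N) = Gamma0Map N γ :=
  exists_mem_Hpow_of_pow γ (gamma0Map_pow_six_mul hN γ (trEntry_mem_of_killed h))

/-- **`H♭` is admissible at every odd level at which `−1` is not a square** ((T) + §R). [folklore] -/
theorem Hflat_admissible {N : ℕ} (hN : Odd N) (hi : ¬ IsSquare (-1 : ZMod N)) (γ : Gamma0 N)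
    (h : IsOfFinOrder γ ∨ trEntry γ = 2 ∨ trEntry γ = -2) :
    ∃ u ∈ Hpow N 3, (u : ZMod N) = Gamma0Map N γ :=
  exists_mem_Hpow_of_pow γ (gamma0Map_pow_three_mul hN hi γ (trEntry_mem_of_killed h))

/-- `2ᵉ ∈ H_c ⟹ 2^{cNe} ≡ ±1`. -/
theorem two_pow_of_mem_Hpow {N c : ℕ} (e : ℕ) (h : ∃ u ∈ Hpow N c, (u : ZMod N) = 2 ^ e) :
    (2 : ZMod N) ^ (c * N * e) = 1 ∨ (2 : ZMod N) ^ (c * N * e) = -1 := by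
  obtain ⟨u, hu, hue⟩ := h
  rw [mem_Hpow, hue, ← pow_mul, show e * (c * N) = c * N * e by ring] at hu
  exact hu

/-- gcd bookkeeping: `k ∣ c·N·e` with `c`, `N` odd ⟹ `gcd(k, 4) ∣ e`. -/
theorem gcd_four_dvd {k c N e : ℕ} (hc : Odd c) (hN : Odd N) (h : k ∣ c * N * e) : Nat.gcd k 4 ∣ e := by
  have hg : Nat.gcd k 4 ∣ (c * N) * e := (Nat.gcd_dvd_left _ _).trans h
  have hodd : Odd (c * N) := hc.mul hN
  have hcop : Nat.Coprime (Nat.gcd k 4) (c * N) := by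
    have h4 : Nat.Coprime 4 (c * N) := by simpa using (Nat.coprime_two_left.mpr hodd).pow_left 2
    exact Nat.Coprime.coprime_dvd_left (Nat.gcd_dvd_right _ _) h4
  exact hcop.dvd_of_dvd_mul_left hg

/-- from `(2 : ℤ/N)^j = s` (`s` an integer) to `N ∣ (2^j − s)²` over `ℤ` (input of `exists_parabolic_dEntry`). -/
theorem natCast_dvd_sq_of_pow_eq {N : ℕ} [NeZero N] (j : ℕ) (s : ℤ) (h : (2 : ZMod N) ^ j = (s : ZMod N)) :
    (N : ℤ) ∣ ((2 : ℤ) ^ j - s) ^ 2 := by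
  apply dvd_pow _ two_ne_zero
  rw [← ZMod.intCast_zmod_eq_zero_iff_dvd]
  push_cast
  rw [h, sub_self]

/-- from `(2 : ℤ/N)^{2j} = −1`: an order-`4` element of `Γ₀(N)` (trace `0`) with `d = 2^j` (`exists_elliptic_dEntry`). -/
theorem exists_isOfFinOrder_dEntry_two_pow {N : ℕ} [NeZero N] (j : ℕ) (h : (2 : ZMod N) ^ (2 * j) = -1) :
    ∃ γ : Gamma0 N, IsOfFinOrder γ ∧ trEntry γ = 0 ∧ dEntry γ = 2 ^ j := by
  have hdvd : (N : ℤ) ∣ (2 : ℤ) ^ (2 * j) + 1 := by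
    rw [← ZMod.intCast_zmod_eq_zero_iff_dvd]
    push_cast
    rw [h, neg_add_cancel]
  obtain ⟨n, hn⟩ := hdvd
  exact FlatWitnessTwo.exists_elliptic_dEntry N (2 ^ j) 0 n (by linear_combination hn) (by norm_num)

/-- **(W) at an odd level where `−1` is NOT a square** (some prime `≡ 3 (mod 4)` divides `N`): `H = H♭`, ONE parabolic
witness — `d = 2^{o/2} ≡ −1` (`k = o/2`) if that power is `≡ −1`, else `d = 2^{o} ≡ 1` (`k = o`), `o := ord_N(2)`; the
`e`-clause is `o ∣ 6Ne` resp. (ζ-lemma) `o ∣ 3Ne`. [folklore] -/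
theorem flatW_of_not_isSquare (N : ℕ) (hN : Odd N) (hN1 : 1 < N) (hi : ¬ IsSquare (-1 : ZMod N)) : FlatW N := by
  haveI : NeZero N := ⟨by omega⟩
  haveI : Fact (2 < N) := ⟨by obtain ⟨r, hr⟩ := hN; omega⟩
  have h3 : Odd 3 := by decide
  set o := orderOf (2 : ZMod N) with ho_def
  have ho1 : (2 : ZMod N) ^ o = 1 := pow_orderOf_eq_one _
  unfold FlatW
  by_cases hζ : Even o ∧ (2 : ZMod N) ^ (o / 2) = -1
  · obtain ⟨ho, hζ⟩ := hζ
    obtain ⟨ρ, hρt, hρd⟩ := FlatWitnessTwo.exists_parabolic_dEntry N (2 ^ (o / 2)) (-1) (Or.inr rfl)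
      (natCast_dvd_sq_of_pow_eq (o / 2) (-1) (by push_cast; exact hζ))
    refine FlatWitnessTwo.flatWitnessAt_of_single (Hpow N 3) (neg_one_mem_Hpow N 3) (Hflat_admissible hN hi)
      ρ (Or.inr (Or.inr (by rw [hρt]; norm_num))) (o / 2) (by rw [hρd]; simp) ?_
    intro e he
    have h1 : (2 : ZMod N) ^ (2 * (3 * N * e)) = 1 := by
      rcases two_pow_of_mem_Hpow e he with h | h
      · rw [mul_comm, pow_mul, h, one_pow]
      · rw [mul_comm, pow_mul, h]
        norm_num
    have hdvd : o ∣ 2 * (3 * N * e) := orderOf_dvd_of_pow_eq_one h1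
    have ho2 : 2 * (o / 2) = o := Nat.two_mul_div_two_of_even ho
    have hdvd' : o / 2 ∣ 3 * N * e := Nat.dvd_of_mul_dvd_mul_left (by norm_num : 0 < 2) (by rw [ho2]; exact hdvd)
    exact gcd_four_dvd h3 hN hdvd'
  · obtain ⟨ρ, hρt, hρd⟩ := FlatWitnessTwo.exists_parabolic_dEntry N (2 ^ o) 1 (Or.inl rfl)
      (natCast_dvd_sq_of_pow_eq o 1 (by push_cast; exact ho1))
    refine FlatWitnessTwo.flatWitnessAt_of_single (Hpow N 3) (neg_one_mem_Hpow N 3) (Hflat_admissible hN hi)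
      ρ (Or.inr (Or.inl (by rw [hρt]; norm_num))) o (by rw [hρd]; simp) ?_
    intro e he
    have h1 : (2 : ZMod N) ^ (3 * N * e) = 1 := by
      rcases two_pow_of_mem_Hpow e he with h | h
      · exact h
      · exact absurd (pow_half_orderOf_eq_neg_one_of_pow_eq_neg_one _ h) hζ
    exact gcd_four_dvd h3 hN (orderOf_dvd_of_pow_eq_one h1)

/-- **(W) at an odd level `N > 1` where `−1 IS a square** (⊇ the v10 residual family: composite, every `p ∣ N` is
`≡ 1 (mod 4)`): `H = H♯`; with `o := ord_N(2)`, `ζ := 2^{o/2}`:  (A3) `o` odd — parabolic `d = 2^o ≡ 1`, `k = o`;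
(B2a) `4 ∣ o`, `ζ ≡ −1` — order-4 `d = 2^{o/4}` (`d² = ζ`), `k = o/4`, `e`-clause `o ∣ 12Ne`;  (A2′) `o ≡ 2 (4)`,
`ζ ≡ −1` — parabolic `d = ζ`, `k = o/2` odd;  (B2b) `o` even, `ζ ≢ −1` — the TWO-ELLIPTIC witness
(`exists_twoElliptic_witness`, Dirichlet), `k = (o/2)·m`, `m` odd, `e`-clause `gcd_dvd_of_pow_six_mul`. [folklore] -/
theorem flatW_of_isSquare (N : ℕ) (hN : Odd N) (hN1 : 1 < N) (hi : IsSquare (-1 : ZMod N)) : FlatW N := by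
  haveI : NeZero N := ⟨by omega⟩
  haveI : Fact (2 < N) := ⟨by obtain ⟨r, hr⟩ := hN; omega⟩
  have h3 : Odd 3 := by decide
  obtain ⟨c, hc⟩ := hi
  have hc2 : c ^ 2 = -1 := by rw [sq]; exact hc.symm
  set o := orderOf (2 : ZMod N) with ho_def
  have ho1 : (2 : ZMod N) ^ o = 1 := pow_orderOf_eq_one _
  unfold FlatW
  rcases Nat.even_or_odd o with ho | ho
  · by_cases hζ : (2 : ZMod N) ^ (o / 2) = -1
    · by_cases h4 : 4 ∣ o
      · -- (B2a)
        obtain ⟨q, hq⟩ := h4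
        have hq2 : o / 2 = 2 * q := by rw [hq]; omega
        obtain ⟨ρ, hρf, -, hρd⟩ := exists_isOfFinOrder_dEntry_two_pow (N := N) q (by rw [← hq2]; exact hζ)
        refine FlatWitnessTwo.flatWitnessAt_of_single (Hpow N 6) (neg_one_mem_Hpow N 6) (Hsharp_admissible hN)
          ρ (Or.inl hρf) q (by rw [hρd]; simp) ?_
        intro e he
        have h1 : (2 : ZMod N) ^ (2 * (6 * N * e)) = 1 := by
          rcases two_pow_of_mem_Hpow e he with h | h
          · rw [mul_comm, pow_mul, h, one_pow]
          · rw [mul_comm, pow_mul, h]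
            norm_num
        have hdvd : o ∣ 4 * (3 * N * e) := by
          rw [show 4 * (3 * N * e) = 2 * (6 * N * e) by ring]
          exact orderOf_dvd_of_pow_eq_one h1
        have hdvd' : q ∣ 3 * N * e := Nat.dvd_of_mul_dvd_mul_left (by norm_num : 0 < 4) (by rw [← hq]; exact hdvd)
        exact gcd_four_dvd h3 hN hdvd'
      · -- (A2′)
        have hk : Odd (o / 2) := by
          rcases Nat.even_or_odd (o / 2) with h | h
          · exfalso
            apply h4
            obtain ⟨r, hr⟩ := h
            have := Nat.two_mul_div_two_of_even ho
            omega
          · exact h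
        obtain ⟨ρ, hρt, hρd⟩ := FlatWitnessTwo.exists_parabolic_dEntry N (2 ^ (o / 2)) (-1) (Or.inr rfl)
          (natCast_dvd_sq_of_pow_eq (o / 2) (-1) (by push_cast; exact hζ))
        refine FlatWitnessTwo.flatWitnessAt_of_single (Hpow N 6) (neg_one_mem_Hpow N 6) (Hsharp_admissible hN)
          ρ (Or.inr (Or.inr (by rw [hρt]; norm_num))) (o / 2) (by rw [hρd]; simp) ?_
        intro e _
        have hg : Nat.gcd (o / 2) 4 = 1 := by
          have : Nat.Coprime (o / 2) (2 ^ 2) := Nat.Coprime.pow_right 2 (Nat.coprime_two_right.2 hk)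
          simpa using this
        simp [hg]
    · -- (B2b)
      obtain ⟨ρ, hρ, m, hm, hρd⟩ := exists_twoElliptic_witness N hN hN1 c hc2 ho
      refine ⟨Hpow N 6, ρ, o / 2 * m, neg_one_mem_Hpow N 6, Hsharp_admissible hN, Subgroup.mem_sup_left hρ,
        by rw [hρd]; simp [ho_def], ?_⟩
      intro e he
      exact gcd_dvd_of_pow_six_mul hN ho hζ m hm e (two_pow_of_mem_Hpow e he)
  · -- (A3)
    obtain ⟨ρ, hρt, hρd⟩ := FlatWitnessTwo.exists_parabolic_dEntry N (2 ^ o) 1 (Or.inl rfl)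
      (natCast_dvd_sq_of_pow_eq o 1 (by push_cast; exact ho1))
    refine FlatWitnessTwo.flatWitnessAt_of_single (Hpow N 6) (neg_one_mem_Hpow N 6) (Hsharp_admissible hN)
      ρ (Or.inr (Or.inl (by rw [hρt]; norm_num))) o (by rw [hρd]; simp) ?_
    intro e _
    have hg : Nat.gcd o 4 = 1 := by
      have : Nat.Coprime o (2 ^ 2) := Nat.Coprime.pow_right 2 (Nat.coprime_two_right.2 ho)
      simpa using this
    simp [hg]

/-- **(W) at every odd level `N > 1`.** [folklore] -/
theorem flatW (N : ℕ) (hN : Odd N) (hN1 : 1 < N) : FlatW N := by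
  by_cases hi : IsSquare (-1 : ZMod N)
  · exact flatW_of_isSquare N hN hN1 hi
  · exact flatW_of_not_isSquare N hN hN1 hi

/-- **The v9 registered stub `stub_flatWitnessAtTwoComposite` — statement VERBATIM — proved** (the hypothesis
`¬ N.Prime` is not used).  Positive statement: NOT landed by this refuter seat; for the lead to land with stub credit.
[cite: Manin1972, Prop. 1.4] -/
theorem flatWitnessAtTwoComposite : ∀ N : ℕ, Odd N → 1 < N → ¬ N.Prime →
    ∃ (H : Subgroup (ZMod N)ˣ) (ρ : Gamma0 N) (k : ℕ), -1 ∈ H ∧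
      (∀ γ : Gamma0 N, IsOfFinOrder γ ∨ trEntry γ = 2 ∨ trEntry γ = -2 → ∃ u ∈ H, (u : ZMod N) = Gamma0Map N γ) ∧
      ρ ∈ Subgroup.closure {γ : Gamma0 N | IsOfFinOrder γ ∨ trEntry γ = 2 ∨ trEntry γ = -2} ⊔ commutator (Gamma0 N) ∧
      (dEntry ρ).natAbs = 2 ^ k ∧
      ∀ e : ℕ, (∃ u ∈ H, (u : ZMod N) = 2 ^ e) → Nat.gcd k 4 ∣ e :=
  fun N hN hN1 _ => flatW N hN hN1

/-- hence (W) at EVERY odd level — v9's `flatWitnessAtTwo_all`, through the lead's reduction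
`FlatWitnessTwo.flatWitnessAtTwo_of_composite` (p664510). [cite: Manin1972, Prop. 1.4] -/
theorem flatWitnessAtTwo_all (N : ℕ) (hN : Odd N) : FlatW N :=
  FlatWitnessTwo.flatWitnessAtTwo_of_composite flatWitnessAtTwoComposite N hN


end TriageR1Seat2Gen11

end
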